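import Literature.AlgebraicGeometry.Resolution.RegularLocusPerfectFibreScheme
import Literature.AlgebraicGeometry.Resolution.AlterationsLemma32
import Literature.AlgebraicGeometry.Resolution.RegularLocalRingsFlatDescent
import Mathlib.AlgebraicGeometry.IdealSheaf.Functorial
import Mathlib.AlgebraicGeometry.Morphisms.Smooth
import Mathlib.AlgebraicGeometry.Morphisms.Flat
import Mathlib.AlgebraicGeometry.Noetherian
import Mathlib.AlgebraicGeometry.PullbackCarrier
import HarnessLib

/-!
# The singular locus of a closed subscheme is invariant under smooth morphisms and perfect base change

Route `ResolutionOfSingularities/WeightedInvariant`, crux `WeightedConstruction`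
(stmt-ResolutionOfSingularities-0571), line `support-first-weights-second`: the registered stub
`stub_singularLocus_comap_baseChange` of the lead skeleton. For an ideal sheaf `X` on a scheme `Y` write
`XSing X y :↔ ∃ x : X.subscheme, X.subschemeι x = y ∧ ¬ IsRegularLocalRing 𝒪_{X.subscheme, x}` ("`X` is
singular at the point `y` of the ambient scheme"). We prove

* (a) for a smooth morphism `g : Y₁ → Y` of schemes locally of finite type over a field `k`:
  `XSing (X.comap g) y₁ ↔ XSing X (g y₁)`;
* (b) for a cartesian square `pr : YK = Y ×_{Spec k} Spec K → Y` over a homomorphism `φ : k → K` of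
  PERFECT fields, `Y` locally of finite type over `k`: `XSing (X.comap pr) y ↔ XSing X (pr y)`.

Both go through Mathlib's `Scheme.IdealSheafData.comapIso : (X.comap g).subscheme ≅ Y₁ ×_Y X.subscheme`:
points of `(X.comap g).subscheme` over `y₁` correspond to points of `X.subscheme` over `g y₁`
(`Scheme.Pullback.exists_preimage_pullback`), which reduces both statements to one about the stalks of
the second projection `Y₁ ×_Y X.subscheme → X.subscheme` (`xSing_comap_iff_of_stalk_iff`):

* (a) it is smooth, and along a smooth morphism to a locally Noetherian scheme the local ring upstairs
  is regular iff the local ring downstairs is (EGA IV₄ 17.5.8 (iii), `isRegularLocalRing_stalk_of_smooth`;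
  Matsumura Thm. 23.7 (i), `IsRegularLocalRing.of_flat_ringHom`) — `isRegularLocalRing_stalk_iff_of_smooth`;
* (b) it sits in the cartesian square `YK ×_Y X.subscheme = X.subscheme ×_{Spec k} Spec K` (pasting), and
  over a perfect field a point of such a fibre product is regular iff it lies over the smooth locus of
  `X.subscheme → Spec k` (`isRegularLocalRing_stalk_iff_mem_smoothLocus_of_isPullback`, Stacks 038X/056S,
  applied to `K/k` and to the trivial square `k/k`) — `isRegularLocalRing_stalk_iff_mem_smoothLocus_of_field`,
  `isRegularLocalRing_stalk_pullback_iff_of_isPullback_perfectField`.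

No new mathematics is claimed here; everything is assembled from the tree and Mathlib.
-/

noncomputable section

set_option linter.dupNamespace false -- mandated namespace of this single-conjunct summit

open CategoryTheory CategoryTheory.Limits AlgebraicGeometry TopologicalSpace
open Literature.AlgebraicGeometry.Resolution

namespace Summit.ResolutionOfSingularities.ResolutionOfSingularities.Theorems

universe u

/-! ## Point matching through `comapIso` -/

/-- **Reduction to the second projection.** For `g : Y₁ → Y` and an ideal sheaf `X` on `Y`: if for every
point `z` of `Y₁ ×_Y X.subscheme` the local ring at `z` is regular iff the local ring of `X.subscheme` at
`pr₂ z` is, then `X.comap g` is singular at `y₁` iff `X` is singular at `g y₁`. The points of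
`(X.comap g).subscheme ≅ Y₁ ×_Y X.subscheme` (`Scheme.IdealSheafData.comapIso`, an isomorphism, so the
local rings agree) over `y₁` map to points of `X.subscheme` over `g y₁` by `pr₂`, and every such point is
hit (`Scheme.Pullback.exists_preimage_pullback`). [folklore] -/
theorem xSing_comap_iff_of_stalk_iff {Y Y₁ : Scheme.{u}} (g : Y₁ ⟶ Y) (X : Y.IdealSheafData)
    (hreg : ∀ z : ↥(pullback g X.subschemeι),
      IsRegularLocalRing ((pullback g X.subschemeι).presheaf.stalk z) ↔
        IsRegularLocalRing (X.subscheme.presheaf.stalk (pullback.snd g X.subschemeι z)))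
    (y₁ : Y₁) :
    (∃ x₁ : (X.comap g).subscheme, (X.comap g).subschemeι x₁ = y₁ ∧
        ¬ IsRegularLocalRing ((X.comap g).subscheme.presheaf.stalk x₁)) ↔
      ∃ x : X.subscheme, X.subschemeι x = g y₁ ∧
        ¬ IsRegularLocalRing (X.subscheme.presheaf.stalk x) := by
  constructor
  · rintro ⟨x₁, hx₁, hnr⟩
    set z : ↥(pullback g X.subschemeι) := (X.comapIso g).hom x₁ with hz
    have hfst : pullback.fst g X.subschemeι z = y₁ := by
      rw [hz, ← Scheme.Hom.comp_apply, Scheme.IdealSheafData.comapIso_hom_fst, hx₁]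
    refine ⟨pullback.snd g X.subschemeι z, ?_, fun hx => hnr ?_⟩
    · rw [← Scheme.Hom.comp_apply, ← pullback.condition, Scheme.Hom.comp_apply, hfst]
    · exact (isRegularLocalRing_stalk_iff_of_isOpenImmersion (X.comapIso g).hom x₁).mp
        ((hreg z).mpr hx)
  · rintro ⟨x, hx, hnr⟩
    obtain ⟨z, hz₁, hz₂⟩ :=
      Scheme.Pullback.exists_preimage_pullback (f := g) (g := X.subschemeι) y₁ x hx.symm
    refine ⟨(X.comapIso g).inv z, ?_, fun h1 => hnr ?_⟩
    · rw [← Scheme.Hom.comp_apply, Scheme.IdealSheafData.comapIso_inv_subschemeι, hz₁]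
    · rw [← hz₂]
      exact (hreg z).mp
        ((isRegularLocalRing_stalk_iff_of_isOpenImmersion (X.comapIso g).inv z).mp h1)

/-! ## (a) Smooth morphisms -/

/-- **Along a smooth morphism to a locally Noetherian scheme, a local ring upstairs is regular iff the
local ring downstairs is**: `⇐` is EGA IV₄ 17.5.8 (iii) (`isRegularLocalRing_stalk_of_smooth`), `⇒` is
descent of regularity along the flat local homomorphism of stalks (Matsumura, Thm. 23.7 (i),
`IsRegularLocalRing.of_flat_ringHom`; smooth ⇒ flat). [folklore] -/
theorem isRegularLocalRing_stalk_iff_of_smooth {P Z : Scheme.{u}} (h : P ⟶ Z) [Smooth h]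
    [IsLocallyNoetherian Z] (z : P) :
    IsRegularLocalRing (P.presheaf.stalk z) ↔ IsRegularLocalRing (Z.presheaf.stalk (h z)) := by
  refine ⟨fun hz => ?_, fun hx => isRegularLocalRing_stalk_of_smooth h z hx⟩
  haveI := hz
  exact IsRegularLocalRing.of_flat_ringHom (h.stalkMap z).hom (Flat.stalkMap h z)

/-- **(a) The singular locus is invariant under smooth morphisms**: for `g : Y₁ → Y` smooth, `Y` and `Y₁`
locally of finite type over a field `k` (so `X.subscheme`, a closed subscheme of `Y`, is locally
Noetherian), `X.comap g` is singular at `y₁` iff `X` is singular at `g y₁` — the second projection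
`Y₁ ×_Y X.subscheme → X.subscheme` is smooth (base change). [folklore] -/
theorem xSing_comap_iff_of_smooth ⦃k : Type⦄ [Field k] ⦃Y Y₁ : Scheme.{0}⦄ (f : Y ⟶ Spec (.of k))
    [LocallyOfFiniteType f] (f₁ : Y₁ ⟶ Spec (.of k)) [LocallyOfFiniteType f₁] (g : Y₁ ⟶ Y) [Smooth g]
    (_hg : g ≫ f = f₁) (X : Y.IdealSheafData) (y₁ : Y₁) :
    (∃ x₁ : (X.comap g).subscheme, (X.comap g).subschemeι x₁ = y₁ ∧
        ¬ IsRegularLocalRing ((X.comap g).subscheme.presheaf.stalk x₁)) ↔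
      ∃ x : X.subscheme, X.subschemeι x = g y₁ ∧
        ¬ IsRegularLocalRing (X.subscheme.presheaf.stalk x) := by
  haveI : IsLocallyNoetherian X.subscheme :=
    LocallyOfFiniteType.isLocallyNoetherian (X.subschemeι ≫ f)
  exact xSing_comap_iff_of_stalk_iff g X
    (fun z => isRegularLocalRing_stalk_iff_of_smooth (pullback.snd g X.subschemeι) z) y₁

/-! ## (b) Base change to a perfect extension field -/

/-- **Over a perfect field, a point is regular iff it is a smooth point**: for `q : Z → Spec k` locally of
finite type, `k` perfect, and `x ∈ Z`, the local ring `𝒪_{Z,x}` is regular iff `x` lies in the smooth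
locus of `q` — the tree's fibre statement `isRegularLocalRing_stalk_iff_mem_smoothLocus_of_isPullback`
(Stacks 038X with 00TF/056S) for the trivial cartesian square `Z = Z ×_{Spec k} Spec k` (`q` is flat, the
base being a field, and locally of finite presentation, the base being Noetherian). [folklore] -/
theorem isRegularLocalRing_stalk_iff_mem_smoothLocus_of_field {k : Type u} [Field k] [PerfectField k]
    {Z : Scheme.{u}} (q : Z ⟶ Spec (.of k)) [LocallyOfFiniteType q] (x : Z) :
    IsRegularLocalRing (Z.presheaf.stalk x) ↔ x ∈ q.smoothLocus := by
  haveI : Subsingleton ↥(Spec (CommRingCat.of k)) :=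
    inferInstanceAs (Subsingleton (PrimeSpectrum k))
  haveI : Flat q := inferInstance
  haveI : LocallyOfFinitePresentation q := inferInstance
  have h1 : specOfAlgebra k k = 𝟙 (Spec (.of k)) := by
    change Spec.map (CommRingCat.ofHom (algebraMap k k)) = _
    rw [Algebra.algebraMap_self, CommRingCat.ofHom_id, Spec.map_id]
  have H0 : IsPullback (𝟙 Z) q q (specOfAlgebra k k) := by
    rw [h1]
    exact IsPullback.id_horiz q
  exact isRegularLocalRing_stalk_iff_mem_smoothLocus_of_isPullback k q H0 x

/-- **Regular points of `YK ×_Y Z` and of `Z` correspond, for `YK = Y ×_{Spec k} Spec K` with `k ⊆ K`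
perfect**: for `q : Z → Y → Spec k` locally of finite type (`Z = X.subscheme ↪ Y` a closed subscheme),
the square `YK ×_Y Z → Z → Spec k`, `YK ×_Y Z → YK → Spec K` is cartesian (pasting), so a point `z` of
`YK ×_Y Z` is regular iff `pr₂ z` lies in the smooth locus of `Z → Spec k`
(`isRegularLocalRing_stalk_iff_mem_smoothLocus_of_isPullback` over the perfect field `K`), iff `pr₂ z` is
a regular point of `Z` (the same over the perfect field `k`). [folklore] -/
theorem isRegularLocalRing_stalk_pullback_iff_of_isPullback_perfectField ⦃k : Type⦄ [Field k]
    [PerfectField k] ⦃K : Type⦄ [Field K] [PerfectField K] (φ : k →+* K) ⦃Y YK : Scheme.{0}⦄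
    (f : Y ⟶ Spec (.of k)) [LocallyOfFiniteType f] (fK : YK ⟶ Spec (.of K)) (pr : YK ⟶ Y)
    (hpb : IsPullback pr fK f (Spec.map (CommRingCat.ofHom φ))) (X : Y.IdealSheafData)
    (z : ↥(pullback pr X.subschemeι)) :
    IsRegularLocalRing ((pullback pr X.subschemeι).presheaf.stalk z) ↔
      IsRegularLocalRing (X.subscheme.presheaf.stalk (pullback.snd pr X.subschemeι z)) := by
  letI : Algebra k K := φ.toAlgebra
  haveI : Subsingleton ↥(Spec (CommRingCat.of k)) :=
    inferInstanceAs (Subsingleton (PrimeSpectrum k))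
  haveI : Flat (X.subschemeι ≫ f) := inferInstance
  haveI : LocallyOfFinitePresentation (X.subschemeι ≫ f) := inferInstance
  have hpb' : IsPullback pr fK f (specOfAlgebra k K) := hpb
  have HK : IsPullback (pullback.snd pr X.subschemeι) (pullback.fst pr X.subschemeι ≫ fK)
      (X.subschemeι ≫ f) (specOfAlgebra k K) :=
    (IsPullback.of_hasPullback pr X.subschemeι).flip.paste_vert hpb'
  rw [isRegularLocalRing_stalk_iff_mem_smoothLocus_of_isPullback K (X.subschemeι ≫ f) HK z,
    isRegularLocalRing_stalk_iff_mem_smoothLocus_of_field (X.subschemeι ≫ f)]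

/-- **(b) The singular locus is invariant under base change to a perfect extension field**: for a cartesian
square `pr : YK = Y ×_{Spec k} Spec K → Y` over `φ : k → K` with `k`, `K` perfect and `Y` locally of finite
type over `k`, `X.comap pr` is singular at `y` iff `X` is singular at `pr y`. [folklore] -/
theorem xSing_comap_iff_of_isPullback_perfectField ⦃k : Type⦄ [Field k] [PerfectField k] ⦃K : Type⦄
    [Field K] [PerfectField K] (φ : k →+* K) ⦃Y YK : Scheme.{0}⦄ (f : Y ⟶ Spec (.of k))
    [LocallyOfFiniteType f] (fK : YK ⟶ Spec (.of K)) (pr : YK ⟶ Y)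
    (hpb : IsPullback pr fK f (Spec.map (CommRingCat.ofHom φ))) (X : Y.IdealSheafData) (y : YK) :
    (∃ x' : (X.comap pr).subscheme, (X.comap pr).subschemeι x' = y ∧
        ¬ IsRegularLocalRing ((X.comap pr).subscheme.presheaf.stalk x')) ↔
      ∃ x : X.subscheme, X.subschemeι x = pr y ∧
        ¬ IsRegularLocalRing (X.subscheme.presheaf.stalk x) :=
  xSing_comap_iff_of_stalk_iff pr X
    (isRegularLocalRing_stalk_pullback_iff_of_isPullback_perfectField φ f fK pr hpb X) y

/-! ## The registered stub -/

/-- `stub_singularLocus_comap_baseChange` of the line `support-first-weights-second` (crux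
`WeightedConstruction`, stmt-ResolutionOfSingularities-0571): singularity of `X` at a point of the ambient
scheme is invariant (a) under smooth `k`-morphisms `g : Y₁ → Y` (`xSing_comap_iff_of_smooth`) and (b) under
base change to a perfect extension field of the perfect ground field
(`xSing_comap_iff_of_isPullback_perfectField`). [folklore] -/
theorem stub_singularLocus_comap_baseChange :
    (∀ ⦃k : Type⦄ [Field k] ⦃Y Y₁ : Scheme.{0}⦄ (f : Y ⟶ Spec (.of k)) [LocallyOfFiniteType f]
      (f₁ : Y₁ ⟶ Spec (.of k)) [LocallyOfFiniteType f₁] (g : Y₁ ⟶ Y) [Smooth g], g ≫ f = f₁ →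
      ∀ (X : Y.IdealSheafData) (y₁ : Y₁),
      (∃ x₁ : (X.comap g).subscheme, (X.comap g).subschemeι x₁ = y₁ ∧
          ¬ IsRegularLocalRing ((X.comap g).subscheme.presheaf.stalk x₁)) ↔
        ∃ x : X.subscheme, X.subschemeι x = g y₁ ∧
          ¬ IsRegularLocalRing (X.subscheme.presheaf.stalk x)) ∧
    (∀ ⦃k : Type⦄ [Field k] [PerfectField k] ⦃K : Type⦄ [Field K] [PerfectField K] (φ : k →+* K)
      ⦃Y YK : Scheme.{0}⦄ (f : Y ⟶ Spec (.of k)) [LocallyOfFiniteType f] (fK : YK ⟶ Spec (.of K))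
      (pr : YK ⟶ Y), IsPullback pr fK f (Spec.map (CommRingCat.ofHom φ)) →
      ∀ (X : Y.IdealSheafData) (y : YK),
      (∃ x' : (X.comap pr).subscheme, (X.comap pr).subschemeι x' = y ∧
          ¬ IsRegularLocalRing ((X.comap pr).subscheme.presheaf.stalk x')) ↔
        ∃ x : X.subscheme, X.subschemeι x = pr y ∧
          ¬ IsRegularLocalRing (X.subscheme.presheaf.stalk x)) :=
  ⟨fun _ _ _ _ f _ f₁ _ g _ hg X y₁ => xSing_comap_iff_of_smooth f f₁ g hg X y₁,
    fun _ _ _ _ _ _ φ _ _ f _ fK pr hpb X y => xSing_comap_iff_of_isPullback_perfectField φ f fK pr hpb X y⟩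

end Summit.ResolutionOfSingularities.ResolutionOfSingularities.Theorems

end
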